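import Mathlib.LinearAlgebra.AffineSpace.AffineEquiv
import Summits.AtomisticToContinuum.Crystallization.Theorems.FreeSplittingCertificatesStrictSplittingRuleP1Field

/-!
# `StrictSplittingRule` (stmt-AtomisticToContinuum-12560): the FAR INEQUALITY for the P1 interpolant of a lattice displacement (at the origin and re-based at any site), and its cell gradient (P1 interpolant object, part 7)

Route `FreeSplittingCertificates`, crux r3 `StrictSplittingRule` (H12⋆ = `stub_coreJointCoercive`), unit b2b-freesplit-B gen 20.
VALUE = item (2) of HOME FAR-LEMMA-SPEC §15 (d), analytic part, CLOSED: the far half of the H12⋆ assembly is now an unconditional theorem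
about a concrete field — `farPencil4_weighted_integral_le_p1Disp` (any pointwise inflated-pencil certificate; instance D
`farPencilD_weighted_integral_le_p1Disp`): for `a, h > 0`, any finitely supported `U : ℤ³ → ℝ³`, any `b₀, A`,
`v = p1Disp a h U b₀ A = (P1 interpolant of U) − (b₀ + y·A)` satisfies `∫χ²N(v) ≤ t∫χ²Den(v) + ∫2χ⟪∇χ,Φ(v)⟫` with the ledger's weight
`χ = fpChi R₁² R₂²`; and the version RE-BASED AT ANY POINT `y₀` (`…_translate`: the field `y ↦ p1Disp a h U b₀ A (y₀ + y)`, which at a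
site `y₀ = y_p` with `b₀ = u_p − W y_p`, `A = W` is the far-ledger variable `ũ(y_p + y) − u_p − W y` of site `p`, EITHER parity — no
re-rooting of the lattice needed).  Plus the interface with the element algebra (`fpRec_le_tet`, `hcpOctUp_receipts`, …): on the interior of a
real cell `fpGrad v` is the constant matrix `p1CellGrad − A` (`fpGrad_p1Disp`), and the cell gradient maps vertex differences of hcp sites to
value differences (`p1CellGrad_vertex_sub`, the shape of the hypotheses `h11 … h45` of the octahedron lemmas).  NOT a proof of H12⋆, NOT
summit progress.  [folklore: P1 finite elements]
-/

noncomputable section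

open Set Function Metric MeasureTheory Filter Topology
open scoped NNReal

namespace Summit.AtomisticToContinuum.Crystallization.Theorems.StrictSplittingRuleBirth

open Summit.AtomisticToContinuum.Crystallization.Theorems.PalmUnimodularRigidity.LayeredLawsSelectHcp (hcpSite)

variable {E : Type*} [NormedAddCommGroup E] [NormedSpace ℝ E]

/-! ## The far inequality at the origin -/

/-- **THE FAR INEQUALITY FOR THE INTERPOLANT** (item (2) of FAR-LEMMA-SPEC §15 (d), analytic part, DISCHARGED): for every pointwise
inflated-pencil certificate `N + divΦ ≤ t·Den`, every `a, h > 0`, every finitely supported lattice displacement `U` and affine field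
`b₀ + y·A`, the field `v = p1Disp a h U b₀ A` (continuous, piecewise affine on the hcp tet/quarter-oct honeycomb) satisfies
`∫ χ²·N(v) ≤ t·∫ χ²·Den(v) + ∫ 2χ⟪∇χ, Φ(v)⟫` with the ledger's weight `χ = fpChi R₁² R₂²`.  NOT a proof of H12⋆, NOT summit progress. -/
theorem farPencil4_weighted_integral_le_p1Disp {fS fA D C c₁ c₂ c₃ c₄ t : ℝ}
    (hcert : ∀ (x w : Fin 3 → ℝ) (G : Fin 3 → Fin 3 → ℝ), x ≠ 0 → fpNumI fS fA D C x w G + fpDivFlux4 c₁ c₂ c₃ c₄ x w G ≤ t * fpDen x G)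
    {a h : ℝ} (ha : 0 < a) (hh : 0 < h) (U : ℤ × ℤ × ℤ → (Fin 3 → ℝ)) (hU : (support U).Finite) (b₀ : Fin 3 → ℝ)
    (A : Fin 3 → Fin 3 → ℝ) {R1 R2 : ℝ} (hR1 : 0 < R1) (hR12 : R1 < R2) :
    ∫ x, fpChi (R1 ^ 2) (R2 ^ 2) x ^ 2 * fpNumI fS fA D C x (p1Disp a h U b₀ A x) (fpGrad (p1Disp a h U b₀ A) x) ≤
      t * (∫ x, fpChi (R1 ^ 2) (R2 ^ 2) x ^ 2 * fpDen x (fpGrad (p1Disp a h U b₀ A) x)) +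
        ∫ x, 2 * fpChi (R1 ^ 2) (R2 ^ 2) x * fpFlux4DotGrad c₁ c₂ c₃ c₄ (p1Disp a h U b₀ A) (fpChi (R1 ^ 2) (R2 ^ 2)) x := by
  obtain ⟨K, hK⟩ := exists_bound_p1CellMap a h U hU
  obtain ⟨M, hM⟩ := exists_bound_support U hU
  refine farPencil4_weighted_integral_le_of_cellwise (cells := p1RealCell a h) (F := p1Face a h) (P := p1FacetPlane a h)
    (K := K + ‖p1AffCLM A‖₊) (R := (2 * |a| + |h|) * (M + 2)) (b₀ := -b₀) (A := fun i j => -A i j)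
    hcert (continuous_p1Disp a h U b₀ A) (exists_p1RealCell a h) ?_ (frontier_p1RealCell_subset a h) (p1Face_subset_plane a h)
    (p1FacetPlane_ne_top ha.ne' hh.ne') (p1Face_locallyFinite a h) hR1 hR12
    (fun y hy j => p1Disp_tail ha.ne' hh.ne' U hM b₀ A hy j)
  intro i
  exact ⟨p1CellConst a h U i - b₀, p1CellMap a h U i - p1AffCLM A, norm_p1CellMap_sub_le hK A i,
    fun y hy => p1Disp_eq_affine U b₀ A hy⟩

/-- **Instance: certificate D for the interpolant** (`t = 9/40`, the recommended target of FAR-LEMMA-SPEC §14 (d)).  NOT a proof of H12⋆,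
NOT summit progress. -/
theorem farPencilD_weighted_integral_le_p1Disp {a h : ℝ} (ha : 0 < a) (hh : 0 < h) (U : ℤ × ℤ × ℤ → (Fin 3 → ℝ))
    (hU : (support U).Finite) (b₀ : Fin 3 → ℝ) (A : Fin 3 → Fin 3 → ℝ) {R1 R2 : ℝ} (hR1 : 0 < R1) (hR12 : R1 < R2) :
    ∫ x, fpChi (R1 ^ 2) (R2 ^ 2) x ^ 2 * fpNumI (7 / 4) (7 / 4) (6 / 5) (9 / 10) x (p1Disp a h U b₀ A x) (fpGrad (p1Disp a h U b₀ A) x) ≤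
      9 / 40 * (∫ x, fpChi (R1 ^ 2) (R2 ^ 2) x ^ 2 * fpDen x (fpGrad (p1Disp a h U b₀ A) x)) +
        ∫ x, 2 * fpChi (R1 ^ 2) (R2 ^ 2) x *
          fpFlux4DotGrad (7 / 45) (23 / 30) (-(19 / 40)) (3 / 40) (p1Disp a h U b₀ A) (fpChi (R1 ^ 2) (R2 ^ 2)) x :=
  farPencil4_weighted_integral_le_p1Disp farPencilCert_D ha hh U hU b₀ A hR1 hR12

/-! ## The far inequality re-based at any point -/

/-- A plane translated by `−y₀`: `{y | y₀ + y ∈ P}` (pull-back under the translation `y ↦ y₀ + y`). -/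
def p1TransPlane (y₀ : Fin 3 → ℝ) (P : AffineSubspace ℝ (Fin 3 → ℝ)) : AffineSubspace ℝ (Fin 3 → ℝ) :=
  P.comap (AffineEquiv.constVAdd ℝ (Fin 3 → ℝ) y₀).toAffineMap

/-- Membership in the translated plane. -/
theorem mem_p1TransPlane {y₀ : Fin 3 → ℝ} {P : AffineSubspace ℝ (Fin 3 → ℝ)} {y : Fin 3 → ℝ} :
    y ∈ p1TransPlane y₀ P ↔ y₀ + y ∈ P := by
  rw [p1TransPlane, AffineSubspace.mem_comap]
  rfl

/-- Translates of proper planes are proper. -/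
theorem p1TransPlane_ne_top {y₀ : Fin 3 → ℝ} {P : AffineSubspace ℝ (Fin 3 → ℝ)} (hP : P ≠ ⊤) : p1TransPlane y₀ P ≠ ⊤ := by
  intro htop
  apply hP
  refine SetLike.ext fun z => ⟨fun _ => by simp, fun _ => ?_⟩
  have hz : z - y₀ ∈ p1TransPlane y₀ P := by rw [htop]; simp
  rw [mem_p1TransPlane, add_sub_cancel] at hz
  exact hz

/-- **THE FAR INEQUALITY RE-BASED AT ANY POINT `y₀`** (use `y₀ = y_p`, `b₀ = u_p − W y_p`, `A = W` for the ledger of site `p`, either parity):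
the field `y ↦ p1Disp a h U b₀ A (y₀ + y)` satisfies the weighted far inequality with the ledger's weight centred at the new origin.
NOT a proof of H12⋆, NOT summit progress. -/
theorem farPencil4_weighted_integral_le_p1Disp_translate {fS fA D C c₁ c₂ c₃ c₄ t : ℝ}
    (hcert : ∀ (x w : Fin 3 → ℝ) (G : Fin 3 → Fin 3 → ℝ), x ≠ 0 → fpNumI fS fA D C x w G + fpDivFlux4 c₁ c₂ c₃ c₄ x w G ≤ t * fpDen x G)
    {a h : ℝ} (ha : 0 < a) (hh : 0 < h) (U : ℤ × ℤ × ℤ → (Fin 3 → ℝ)) (hU : (support U).Finite) (y₀ b₀ : Fin 3 → ℝ)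
    (A : Fin 3 → Fin 3 → ℝ) {R1 R2 : ℝ} (hR1 : 0 < R1) (hR12 : R1 < R2) :
    ∫ x, fpChi (R1 ^ 2) (R2 ^ 2) x ^ 2 *
        fpNumI fS fA D C x (p1Disp a h U b₀ A (y₀ + x)) (fpGrad (fun y => p1Disp a h U b₀ A (y₀ + y)) x) ≤
      t * (∫ x, fpChi (R1 ^ 2) (R2 ^ 2) x ^ 2 * fpDen x (fpGrad (fun y => p1Disp a h U b₀ A (y₀ + y)) x)) +
        ∫ x, 2 * fpChi (R1 ^ 2) (R2 ^ 2) x *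
          fpFlux4DotGrad c₁ c₂ c₃ c₄ (fun y => p1Disp a h U b₀ A (y₀ + y)) (fpChi (R1 ^ 2) (R2 ^ 2)) x := by
  obtain ⟨K, hK⟩ := exists_bound_p1CellMap a h U hU
  obtain ⟨M, hM⟩ := exists_bound_support U hU
  have hτ : Continuous fun y : Fin 3 → ℝ => y₀ + y := continuous_const.add continuous_id
  refine farPencil4_weighted_integral_le_of_cellwise (v := fun y => p1Disp a h U b₀ A (y₀ + y))
    (cells := fun i => (fun y => y₀ + y) ⁻¹' p1RealCell a h i) (F := fun k => (fun y => y₀ + y) ⁻¹' p1Face a h k)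
    (P := fun k => p1TransPlane y₀ (p1FacetPlane a h k)) (K := K + ‖p1AffCLM A‖₊)
    (R := (2 * |a| + |h|) * (M + 2) + ‖y₀‖) (b₀ := -(b₀ + p1AffCLM A y₀)) (A := fun i j => -A i j)
    hcert ((continuous_p1Disp a h U b₀ A).comp hτ) (fun y => exists_p1RealCell a h (y₀ + y)) ?_ ?_ ?_
    (fun k => p1TransPlane_ne_top (p1FacetPlane_ne_top ha.ne' hh.ne' k)) ((p1Face_locallyFinite a h).preimage_continuous hτ)
    hR1 hR12 ?_
  · intro i
    refine ⟨(p1CellConst a h U i - b₀) + (p1CellMap a h U i - p1AffCLM A) y₀, p1CellMap a h U i - p1AffCLM A,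
      norm_p1CellMap_sub_le hK A i, fun y hy => ?_⟩
    rw [p1Disp_eq_affine U b₀ A hy, map_add]
    abel
  · intro i
    have hfr := (Homeomorph.addLeft y₀).preimage_frontier (p1RealCell a h i)
    rw [Homeomorph.coe_addLeft] at hfr
    rw [← hfr, ← preimage_iUnion]
    exact preimage_mono (frontier_p1RealCell_subset a h i)
  · intro k y hy
    exact mem_p1TransPlane.2 (p1Face_subset_plane a h k hy)
  · intro y hy j
    have hy' : (2 * |a| + |h|) * (M + 2) ≤ ‖y₀ + y‖ := by
      have := norm_sub_norm_le y y₀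
      have h2 : ‖y‖ - ‖y₀‖ ≤ ‖y₀ + y‖ := by
        calc ‖y‖ - ‖y₀‖ ≤ ‖y - (-y₀)‖ := by simpa using norm_sub_norm_le y (-y₀)
          _ = ‖y₀ + y‖ := by rw [sub_neg_eq_add, add_comm]
      linarith
    rw [p1Disp_tail ha.ne' hh.ne' U hM b₀ A hy' j]
    simp only [Pi.neg_apply, Pi.add_apply, p1AffCLM_apply]
    ring

/-- **Instance: certificate D, re-based at any point.**  NOT a proof of H12⋆, NOT summit progress. -/
theorem farPencilD_weighted_integral_le_p1Disp_translate {a h : ℝ} (ha : 0 < a) (hh : 0 < h) (U : ℤ × ℤ × ℤ → (Fin 3 → ℝ))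
    (hU : (support U).Finite) (y₀ b₀ : Fin 3 → ℝ) (A : Fin 3 → Fin 3 → ℝ) {R1 R2 : ℝ} (hR1 : 0 < R1) (hR12 : R1 < R2) :
    ∫ x, fpChi (R1 ^ 2) (R2 ^ 2) x ^ 2 *
        fpNumI (7 / 4) (7 / 4) (6 / 5) (9 / 10) x (p1Disp a h U b₀ A (y₀ + x)) (fpGrad (fun y => p1Disp a h U b₀ A (y₀ + y)) x) ≤
      9 / 40 * (∫ x, fpChi (R1 ^ 2) (R2 ^ 2) x ^ 2 * fpDen x (fpGrad (fun y => p1Disp a h U b₀ A (y₀ + y)) x)) +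
        ∫ x, 2 * fpChi (R1 ^ 2) (R2 ^ 2) x *
          fpFlux4DotGrad (7 / 45) (23 / 30) (-(19 / 40)) (3 / 40) (fun y => p1Disp a h U b₀ A (y₀ + y)) (fpChi (R1 ^ 2) (R2 ^ 2)) x :=
  farPencil4_weighted_integral_le_p1Disp_translate farPencilCert_D ha hh U hU y₀ b₀ A hR1 hR12

/-! ## The derivative on the interior of a cell -/

/-- On the interior of the real cell `i`, the field has derivative `p1CellMap a h U i`. -/
theorem hasFDerivAt_p1Field {a h : ℝ} (U : ℤ × ℤ × ℤ → E) {i : (ℤ × ℤ × ℤ) × Fin 6} {x : Fin 3 → ℝ}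
    (hx : x ∈ interior (p1RealCell a h i)) : HasFDerivAt (p1Field a h U) (p1CellMap a h U i) x := by
  have hev : p1Field a h U =ᶠ[𝓝 x] fun y => p1CellConst a h U i + p1CellMap a h U i y := by
    filter_upwards [isOpen_interior.mem_nhds hx] with y hy
    exact p1Field_eq_affine U (interior_subset hy)
  exact (((p1CellMap a h U i).hasFDerivAt).const_add (p1CellConst a h U i)).congr_of_eventuallyEq hev

/-- On the interior of the real cell `i`, `fderiv (p1Field a h U) = p1CellMap a h U i`. -/
theorem fderiv_p1Field {a h : ℝ} (U : ℤ × ℤ × ℤ → E) {i : (ℤ × ℤ × ℤ) × Fin 6} {x : Fin 3 → ℝ}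
    (hx : x ∈ interior (p1RealCell a h i)) : fderiv ℝ (p1Field a h U) x = p1CellMap a h U i :=
  (hasFDerivAt_p1Field U hx).fderiv

/-- **The cell gradient as a matrix** in the `fpGrad` convention (`j` = direction, `k` = component): `G j k = (L e_j)_k`. -/
def p1CellGrad (a h : ℝ) (U : ℤ × ℤ × ℤ → (Fin 3 → ℝ)) (i : (ℤ × ℤ × ℤ) × Fin 6) : Fin 3 → Fin 3 → ℝ :=
  fun j k => p1CellMap a h U i (fpE j) k

/-- **`fpGrad` of the field on the interior of a cell is the cell gradient.** -/
theorem fpGrad_p1Field {a h : ℝ} (U : ℤ × ℤ × ℤ → (Fin 3 → ℝ)) {i : (ℤ × ℤ × ℤ) × Fin 6} {x : Fin 3 → ℝ}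
    (hx : x ∈ interior (p1RealCell a h i)) : fpGrad (p1Field a h U) x = p1CellGrad a h U i := by
  funext j k
  rw [fpGrad, fderiv_p1Field U hx]
  rfl

/-- On the interior of the real cell `i`, the far-ledger field `p1Disp` has derivative `p1CellMap − p1AffCLM A`. -/
theorem hasFDerivAt_p1Disp {a h : ℝ} (U : ℤ × ℤ × ℤ → (Fin 3 → ℝ)) (b₀ : Fin 3 → ℝ) (A : Fin 3 → Fin 3 → ℝ)
    {i : (ℤ × ℤ × ℤ) × Fin 6} {x : Fin 3 → ℝ} (hx : x ∈ interior (p1RealCell a h i)) :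
    HasFDerivAt (p1Disp a h U b₀ A) (p1CellMap a h U i - p1AffCLM A) x :=
  (hasFDerivAt_p1Field U hx).sub (((p1AffCLM A).hasFDerivAt).const_add b₀)

/-- **`fpGrad` of `p1Disp` on the interior of a cell**: the cell gradient minus `A` (`fpGrad` convention: `A j k` = ∂ⱼ of component `k`). -/
theorem fpGrad_p1Disp {a h : ℝ} (U : ℤ × ℤ × ℤ → (Fin 3 → ℝ)) (b₀ : Fin 3 → ℝ) (A : Fin 3 → Fin 3 → ℝ)
    {i : (ℤ × ℤ × ℤ) × Fin 6} {x : Fin 3 → ℝ} (hx : x ∈ interior (p1RealCell a h i)) :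
    fpGrad (p1Disp a h U b₀ A) x = fun j k => p1CellGrad a h U i j k - A j k := by
  funext j k
  rw [fpGrad, (hasFDerivAt_p1Disp U b₀ A hx).fderiv]
  fin_cases j <;> simp [p1CellGrad, fpE]

/-! ## Vertices -/

/-- The chart of an integer point is the hcp site (as a vector of `ℝ³`). -/
theorem p1Chart_p1Vec_eq (a h : ℝ) (n : ℤ × ℤ × ℤ) : p1Chart a h (p1Vec n) = fun i => hcpSite a h n i :=
  funext (p1Chart_p1Vec a h n)

/-- The vertices `T(n + v_m)` of the real cell `(n, π)` belong to it. -/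
theorem p1Chart_vert_mem_p1RealCell {a h : ℝ} (ha : a ≠ 0) (hh : h ≠ 0) (i : (ℤ × ℤ × ℤ) × Fin 6) (m : Fin 4) :
    p1Chart a h (p1Vec (i.1 + p1VertOff (p1Par i.1) i.2 m)) ∈ p1RealCell a h i := by
  show p1ChartInv a h (p1Chart a h (p1Vec (i.1 + p1VertOff (p1Par i.1) i.2 m))) ∈ p1Cell i
  rw [p1ChartInv_p1Chart ha hh]
  exact p1Vec_vert_mem_p1Cell i m

/-- The field takes the value `U n` at `T n`. -/
theorem p1Field_p1Chart_p1Vec {a h : ℝ} (ha : a ≠ 0) (hh : h ≠ 0) (U : ℤ × ℤ × ℤ → E) (n : ℤ × ℤ × ℤ) :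
    p1Field a h U (p1Chart a h (p1Vec n)) = U n := by
  rw [p1Field, p1ChartInv_p1Chart ha hh, p1Interp_p1Vec]

/-- **The cell map sends vertex differences to value differences**: `L (y_v − y_w) = U v − U w` for vertices `v, w` of the cell. -/
theorem p1CellMap_vertex_sub {a h : ℝ} (ha : a ≠ 0) (hh : h ≠ 0) (U : ℤ × ℤ × ℤ → E) (i : (ℤ × ℤ × ℤ) × Fin 6) (m m' : Fin 4) :
    p1CellMap a h U i (p1Chart a h (p1Vec (i.1 + p1VertOff (p1Par i.1) i.2 m)) -
        p1Chart a h (p1Vec (i.1 + p1VertOff (p1Par i.1) i.2 m'))) =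
      U (i.1 + p1VertOff (p1Par i.1) i.2 m) - U (i.1 + p1VertOff (p1Par i.1) i.2 m') := by
  have hm := p1Field_eq_affine U (p1Chart_vert_mem_p1RealCell ha hh i m)
  have hm' := p1Field_eq_affine U (p1Chart_vert_mem_p1RealCell ha hh i m')
  rw [p1Field_p1Chart_p1Vec ha hh] at hm hm'
  rw [map_sub, hm, hm']
  abel

/-- The same with the vertices written as hcp sites. -/
theorem p1CellMap_hcpSite_sub {a h : ℝ} (ha : a ≠ 0) (hh : h ≠ 0) (U : ℤ × ℤ × ℤ → E) (i : (ℤ × ℤ × ℤ) × Fin 6) (m m' : Fin 4) :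
    p1CellMap a h U i ((fun j => hcpSite a h (i.1 + p1VertOff (p1Par i.1) i.2 m) j) -
        fun j => hcpSite a h (i.1 + p1VertOff (p1Par i.1) i.2 m') j) =
      U (i.1 + p1VertOff (p1Par i.1) i.2 m) - U (i.1 + p1VertOff (p1Par i.1) i.2 m') := by
  rw [← p1Chart_p1Vec_eq, ← p1Chart_p1Vec_eq]
  exact p1CellMap_vertex_sub ha hh U i m m'

/-- A linear map on `ℝ³` in coordinates: `(L d) k = Σ_j d_j (L e_j) k`. -/
theorem clm_apply_eq_sum_fpE (L : (Fin 3 → ℝ) →L[ℝ] (Fin 3 → ℝ)) (d : Fin 3 → ℝ) (k : Fin 3) :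
    L d k = d 0 * L (fpE 0) k + d 1 * L (fpE 1) k + d 2 * L (fpE 2) k := by
  have h := LinearMap.pi_apply_eq_sum_univ L.toLinearMap d
  have hE : ∀ i : Fin 3, (fun j : Fin 3 => if i = j then (1 : ℝ) else 0) = fpE i := by
    intro i; funext j; simp [fpE, Pi.single_apply, eq_comm]
  simp only [ContinuousLinearMap.coe_coe, hE] at h
  rw [h, Fin.sum_univ_three]
  simp [Pi.add_apply, Pi.smul_apply, smul_eq_mul]

/-- **Vertex identity in matrix form** (the shape of the hypotheses of `hcpOctUp_receipts` / `hcpOctDown_receipts`, up to the index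
transposition of `fpGrad`): for vertices `v = n + v_m`, `w = n + v_m'` of the cell `i` and every component `k`,
`(U v − U w) k = Σ_j (y_v − y_w)_j · G j k` with `G = p1CellGrad a h U i`, `y_v = hcpSite a h v`. -/
theorem p1CellGrad_vertex_sub {a h : ℝ} (ha : a ≠ 0) (hh : h ≠ 0) (U : ℤ × ℤ × ℤ → (Fin 3 → ℝ)) (i : (ℤ × ℤ × ℤ) × Fin 6)
    (m m' : Fin 4) (k : Fin 3) :
    (U (i.1 + p1VertOff (p1Par i.1) i.2 m) - U (i.1 + p1VertOff (p1Par i.1) i.2 m')) k =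
      (hcpSite a h (i.1 + p1VertOff (p1Par i.1) i.2 m) 0 - hcpSite a h (i.1 + p1VertOff (p1Par i.1) i.2 m') 0) *
          p1CellGrad a h U i 0 k +
        (hcpSite a h (i.1 + p1VertOff (p1Par i.1) i.2 m) 1 - hcpSite a h (i.1 + p1VertOff (p1Par i.1) i.2 m') 1) *
          p1CellGrad a h U i 1 k +
        (hcpSite a h (i.1 + p1VertOff (p1Par i.1) i.2 m) 2 - hcpSite a h (i.1 + p1VertOff (p1Par i.1) i.2 m') 2) *
          p1CellGrad a h U i 2 k := by
  rw [← p1CellMap_hcpSite_sub ha hh U i m m', clm_apply_eq_sum_fpE]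
  rfl


/-! ## Almost-everywhere form: the gradient is cellwise constant, cell integrals are volumes -/

/-- The frontier of a real cell is Lebesgue-null (it lies in finitely many proper planes). -/
theorem volume_frontier_p1RealCell {a h : ℝ} (ha : a ≠ 0) (hh : h ≠ 0) (i : (ℤ × ℤ × ℤ) × Fin 6) :
    volume (frontier (p1RealCell a h i)) = 0 :=
  volume_eq_zero_of_subset_iUnion_affineSubspace (p1FacetPlane a h) (p1FacetPlane_ne_top ha hh)
    ((frontier_p1RealCell_subset a h i).trans (iUnion_mono (p1Face_subset_plane a h)))

/-- **A.e. on a real cell, `fpGrad` of the far-ledger field is the constant matrix `p1CellGrad − A`.** -/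
theorem fpGrad_p1Disp_ae {a h : ℝ} (ha : a ≠ 0) (hh : h ≠ 0) (U : ℤ × ℤ × ℤ → (Fin 3 → ℝ)) (b₀ : Fin 3 → ℝ)
    (A : Fin 3 → Fin 3 → ℝ) (i : (ℤ × ℤ × ℤ) × Fin 6) :
    ∀ᵐ x ∂volume, x ∈ p1RealCell a h i → fpGrad (p1Disp a h U b₀ A) x = fun j k => p1CellGrad a h U i j k - A j k := by
  have hnull : volume (p1RealCell a h i \ interior (p1RealCell a h i)) = 0 := by
    rw [← (isClosed_p1RealCell a h i).frontier_eq]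
    exact volume_frontier_p1RealCell ha hh i
  refine (ae_iff.2 (measure_mono_null ?_ hnull))
  intro x hx
  simp only [mem_setOf_eq, Classical.not_imp] at hx
  exact ⟨hx.1, fun hint => hx.2 (fpGrad_p1Disp U b₀ A hint)⟩

/-- **Cell integrals of gradient functionals are volumes**: for any `g`, `∫_{cell i} g(fpGrad v x) dx = |cell i| · g(G_i − A)` — the form in
which the element algebra (`fpRec_le_tet`, `hcpOctUp_receipts`: inequalities for a CONSTANT gradient) enters the far ledger's integrals. -/
theorem setIntegral_p1RealCell_fpGrad {a h : ℝ} (ha : a ≠ 0) (hh : h ≠ 0) (U : ℤ × ℤ × ℤ → (Fin 3 → ℝ)) (b₀ : Fin 3 → ℝ)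
    (A : Fin 3 → Fin 3 → ℝ) (i : (ℤ × ℤ × ℤ) × Fin 6) (g : (Fin 3 → Fin 3 → ℝ) → ℝ) :
    ∫ x in p1RealCell a h i, g (fpGrad (p1Disp a h U b₀ A) x) =
      (volume (p1RealCell a h i)).toReal * g (fun j k => p1CellGrad a h U i j k - A j k) := by
  rw [setIntegral_congr_ae (isClosed_p1RealCell a h i).measurableSet
      ((fpGrad_p1Disp_ae ha hh U b₀ A i).mono fun x hx hmem => by rw [hx hmem]),
    setIntegral_const, smul_eq_mul, Measure.real]

end Summit.AtomisticToContinuum.Crystallization.Theorems.StrictSplittingRuleBirth
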